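import Summits.BirchSwinnertonDyer.BirchSwinnertonDyer.Theorems.AdditiveKolyvaginRoadKolyvaginClassOfQuadraticLowerHalves
import Summits.BirchSwinnertonDyer.BirchSwinnertonDyer.Theorems.AdditiveKolyvaginRoadSpadeOneTwistTransport
import Summits.BirchSwinnertonDyer.Rank1Residual.X2.TwistKodaira
import Summits.BirchSwinnertonDyer.Rank1Residual.X11b.CastellaErratumTwist
import Literature.NumberTheory.QuadraticFields.FundamentalDiscriminant
import HarnessLib

/-!
# Route `AdditiveKolyvaginRoad`: the per-frame quadratic half-descent to a non-zero Kolyvagin class WITH THE TAMAGAWA BINDERS OF THE FRAME AND OF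
# BOTH PARTNER TWISTS DISCHARGED FROM ♠(1) (crux KS′ `LevelKolyvaginSystemsAdditive`, item stmt-BirchSwinnertonDyer-21396; cards
# `inert-theta-refinement` ∕ `parahoric-ordinary-type-engine`; cell `pub/bsd-wall`, width seat `bsd-wall-akr-p2x-w3` g11; `--supports` 21396, helper)

THEOREMS ONLY (no definition, no named fact, no `sorry`); every half of `BSD_p` and every published input is a HYPOTHESIS.  BSD is not proved
by any of this; KS′ and KPA′ stay OPEN at `p² ∣ N`; Kolyvagin's conjecture is not asserted.

THE POINT.  `AdditiveKoly.exists_kolyvaginClass_ne_zero_of_quadraticLowerHalves_of_kato` (sibling file) carries three Tamagawa binders —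
`p ∤ ∏ c_ℓ(E)`, `p ∤ ∏ c_ℓ(W₁)`, `p ∤ ∏ c_ℓ(W₂)` for the two rank-`0` partner twists.  At `p ≥ 5` all three follow from the crux frame's OWN
hypothesis ♠(1) «`p ∤ ord_ℓ Δ_min(E)` at every multiplicative `ℓ`» (`…SpadeOneTwistTransport.lean`), provided the auxiliary `c_i` are `ℓ`-adic
units at the additive primes (of `E`, resp. of the chosen minimal model `Wd₀` of `E^{(d_K)}` — i.e. of `E` and at the primes of `d_K`) and `E` is
good or multiplicative at `2`.  This file records that form:

* §1 `good_or_mult_two_of_model_heegnerTwist` — for `d_K` odd under the Heegner hypothesis, «`E` not additive at `2`» passes to every model of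
  `E^{(d_K)}` (`2 ∣ N` ⟹ `d_K ∈ (ℚ₂^×)²`; `2 ∤ N` ⟹ `d_K ≡ 1 (mod 4)` and good reduction is kept, `X2.hasGoodReductionAt_twist_of_not_dvd`).
* §2 `exists_kolyvaginClass_ne_zero_of_quadraticLowerHalves_of_kato_of_spadeOne` — the per-frame theorem with `htam`, `htam₁`, `htam₂` and
  `ord_p c₁ = 0` replaced by ♠(1), `E` not additive at `2`, and the unit conditions on `c₁` (at the additive primes of `E`) and `c₂` (at the
  additive primes of `Wd₀`).  What is left on the partner packages: the quadratic fields with these unit conditions, `r_an(W_i) = 0` (sign),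
  the Manin data, and the two LOWER halves over `K₁`, `K₂` (the engines).

References (locators only): [cite: SilvermanAEC2009, VII.5 Prop. 5.1, X.5 Cor. 5.4] [cite: SilvermanATAEC1994, Cor. IV.9.2 (d)]
[cite: JetchevSkinnerWan2017, §7.4.1 (eq:tamK), §7.4.3] [cite: Kato2004Asterisque, Thm. 14.5 (3)] [cite: McCallumLMS1991, §5 Cor. 5.6].
-/

-- single-conjunct summit: `Summit.BirchSwinnertonDyer.BirchSwinnertonDyer.…` repeats the name by design
set_option linter.dupNamespace false
set_option autoImplicit false

noncomputable section

open scoped Classical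

namespace Summit.BirchSwinnertonDyer.BirchSwinnertonDyer.Theorems.AdditiveKoly

open WeierstrassCurve NumberField Rat.HeightOneSpectrum
  Literature.NumberTheory.EllipticCurves Literature.NumberTheory.EllipticCurves.ModularForms
  Literature.NumberTheory.EllipticCurves.Rank1Residual Literature.NumberTheory.EllipticCurves.Rank1Residual.Typed
  Summit.BirchSwinnertonDyer.Rank1Residual Summit.BirchSwinnertonDyer.Rank1Residual.Additive
  Summit.BirchSwinnertonDyer.BirchSwinnertonDyer.Theses.AdditiveKolyvaginRoad

/-! ## §1 «not additive at `2`» passes to the Heegner twist -/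

/-- **If `E` is good or multiplicative at `2`, so is every model `Wd` of the Heegner twist `E^{(d_K)}`** (`K` imaginary quadratic, `d_K` odd,
Heegner hypothesis for the conductor of the globally minimal `W`).  If `E` is multiplicative at `2` then `2 ∣ N` splits in `K`, `d_K` is a `2`-adic
square and `Wd ≅ W` over `ℚ₂` (`X11b.mult_iff_of_twist`); if `E` is good at `2` then `d_K ≡ 1 (mod 4)` (odd fundamental discriminant) and the
unramified twist keeps good reduction (`X2.hasGoodReductionAt_twist_of_not_dvd`). [cite: SilvermanAEC2009, VII.5 Prop. 5.1 and X.5 Cor. 5.4] -/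
theorem good_or_mult_two_of_model_heegnerTwist (W : WeierstrassCurve ℚ) [W.IsElliptic] [W.IsGloballyMinimal]
    (K : Type) [Field K] [NumberField K] (hK : IsImaginaryQuadratic K) (hodd : Odd (NumberField.discr K))
    (hH : SatisfiesHeegnerHypothesis (W.conductorNorm ℤ) K)
    (Wd : WeierstrassCurve ℚ) [Wd.IsElliptic] (Cd : VariableChange ℚ) (hWd : Cd • W.quadraticTwist (NumberField.discr K : ℚ) = Wd)
    (h2 : W.HasGoodReductionAtPrime 2 ∨ W.HasMultiplicativeReductionAtPrime 2) :
    Wd.HasGoodReductionAtPrime 2 ∨ Wd.HasMultiplicativeReductionAtPrime 2 := by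
  have hD0 : (NumberField.discr K : ℚ) ≠ 0 := by exact_mod_cast NumberField.discr_ne_zero K
  rcases h2 with hg | hm
  · -- `2 ∤ d_K`, `d_K ≡ 1 (mod 4)`: good reduction is kept
    left
    have h4 : NumberField.discr K = 4 * (NumberField.discr K / 4) + 1 := by
      rcases Literature.NumberTheory.QuadraticFields.Quadratic.isFundamentalDiscriminant_discr (K := K) hK.1 with
        ⟨h1, -, -⟩ | ⟨h4, -, -⟩
      · omega
      · exfalso
        obtain ⟨k, hk⟩ := h4
        obtain ⟨m, hm⟩ := hodd
        omega
    have h2d : ¬ ((2 : ℕ) : ℤ) ∣ NumberField.discr K := by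
      intro h
      obtain ⟨m, hm⟩ := hodd
      omega
    -- the place of `𝓞 ℚ` over `2`
    obtain ⟨v, hv⟩ : ∃ v : IsDedekindDomain.HeightOneSpectrum (𝓞 ℚ), ((primesEquiv v : ℕ)) = 2 :=
      ⟨primesEquiv.symm ⟨2, Nat.prime_two⟩, by rw [Equiv.apply_symm_apply]⟩
    have hgood' : W.HasGoodReductionAt v := by
      rw [← hasGoodReductionAtPrime_iff_hasGoodReductionAt_ringOfIntegers v W]
      convert hg
    have hgoodd : Wd.HasGoodReductionAt v :=
      X2.hasGoodReductionAt_twist_of_not_dvd W v h4 (by rw [hv]; exact h2d) hgood' Cd hWd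
    rw [← hasGoodReductionAtPrime_iff_hasGoodReductionAt_ringOfIntegers v Wd] at hgoodd
    convert hgoodd; exact hv.symm
  · -- `2 ∣ N` splits in `K`: `d_K` is a `2`-adic square, the curves are `ℚ₂`-isomorphic
    right
    have h2N : 2 ∣ W.conductorNorm ℤ :=
      (W.dvd_conductorNorm_iff_not_hasGoodReductionAtPrime 2).mpr
        (QuadraticDescent.not_hasGoodReductionAtPrime_of_j_eq_of_mult W W rfl 2 hm)
    have hsq' : IsSquare (algebraMap ℚ ℚ_[2] (NumberField.discr K : ℚ)) := X11b.isSquare_discr_padic_of_heegner K hK hH 2 h2N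
    have hsq : IsSquare (((NumberField.discr K : ℚ) : ℚ) : ℚ_[2]) := by simpa using hsq'
    exact (X11b.mult_iff_of_twist W hD0 hsq Wd hWd).mpr hm

/-! ## §2 The per-frame theorem with the Tamagawa binders discharged from ♠(1) -/

section Frame

-- `K : Type`: the tree's ring-class class field theory is universe `0` (as in the crux).
variable (W : WeierstrassCurve ℚ) [W.IsElliptic] [W.IsGloballyMinimal] [NeZero (W.conductorNorm ℤ)]
  (p : ℕ) [hp : Fact p.Prime] (K : Type) [Field K] [NumberField K]
  (Dt : ModularParametrizationData W (W.conductorNorm ℤ)) (β : ℤ) (ι : K →+* ℂ)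

/-- **KOLYVAGIN'S CONJECTURE MOD `p` AT ONE ADDITIVE POTENTIALLY GOOD ♯ FRAME FROM THE LOWER HALVES OVER TWO AUXILIARY QUADRATIC FIELDS AND KATO,
Tamagawa binders from ♠(1).**  As `exists_kolyvaginClass_ne_zero_of_quadraticLowerHalves_of_kato` with: the frame's `p ∤ ∏ c_ℓ(E)` REPLACED by
♠(1) `hsp` («`p ∤ ord_ℓ Δ_min(E)` at every multiplicative `ℓ`», a binder of the crux) plus «`E` good or multiplicative at `2`» (`h2`); PACKAGE 1's
`ord_p c₁ = 0` and `p ∤ ∏ c_ℓ(W₁)` REPLACED by «`c₁` is an `ℓ`-adic unit at every additive prime `ℓ` of `E`» (`hdu₁`; it contains `ℓ = p`);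
PACKAGE 2's `p ∤ ∏ c_ℓ(W₂)` REPLACED by «`c₂` is a unit at every additive prime of `Wd₀`» (`hdu₂`: the additive primes of `E` and the primes of
`d_K`).  Proof: `not_dvd_tamagawaProduct_of_spadeOne` (frame), `not_dvd_tamagawaProduct_of_model_unit_twist_of_spadeOne` (partner 1),
`spadeOne_of_model_heegnerTwist` + §1 + the same (partner 2), then the sibling theorem.  CONDITIONAL on every binder; nothing is booked.
[cite: Kato2004Asterisque, Thm. 14.5 (3) (p. 236)] [cite: SilvermanATAEC1994, Cor. IV.9.2 (d)] [cite: JetchevSkinnerWan2017, §7.4.1, §7.4.3]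
[cite: McCallumLMS1991, §5 Cor. 5.6 (p. 310)] [cite: Miller2011LMS, Def. 1.1] -/
theorem exists_kolyvaginClass_ne_zero_of_quadraticLowerHalves_of_kato_of_spadeOne
    -- published inputs (named facts of the tree)
    (hGZ : gross_zagier (W.conductorNorm ℤ) W K) (hKo : kolyvagin (W.conductorNorm ℤ) W K)
    (hKoB : Kolyvagin1990_padicValNat_card_sha_le (W.conductorNorm ℤ) W K)
    (hGZK : rank_eq_analyticRank_of_analyticRank_le_one) (hmod : hasEntireLFunction_rat)
    (hMc : McCallum1991_padicValNat_card_sha_primary_add_le_of_globalDivisibility)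
    (hDD : Milne1972.bsdQuotientP_baseChange_relQuadratic_anyModel)
    (hKato : Kato2004.rankZero_padicValNat_sha_le_of_additive_potGood_of_imageContainsSL2)
    -- the frame, potentially good at `p`, with ♠(1) and `E` not additive at `2`
    (hp5 : 5 ≤ p) (hadd : Addv W p) (hpot : 0 ≤ padicValRat p W.j) (hs : W.HasSurjectiveModNGaloisRep p) (hCM : ¬ W.HasCM)
    (hsp : ∀ (ℓ : ℕ) [Fact ℓ.Prime], W.HasMultiplicativeReductionAtPrime ℓ → ¬ p ∣ padicValInt ℓ W.minimalDiscriminantInt)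
    (h2 : W.HasGoodReductionAtPrime 2 ∨ W.HasMultiplicativeReductionAtPrime 2) (hr : W.analyticRank = 1)
    (hK : IsImaginaryQuadratic K) (hodd : Odd (NumberField.discr K)) (hlt : NumberField.discr K < -4)
    (hH : SatisfiesHeegnerHypothesis (W.conductorNorm ℤ) K)
    (hL : (W.quadraticTwist (NumberField.discr K : ℚ)).entireLFunction 1 ≠ 0)
    (hβ : (4 * (W.conductorNorm ℤ : ℤ)) ∣ β ^ 2 - NumberField.discr K) (hc : ¬ (p : ℤ) ∣ Dt.c)
    -- PACKAGE 1
    (K₁ : Type) [Field K₁] [NumberField K₁] (h2₁ : Module.finrank ℚ K₁ = 2)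
    {c₁ : ℚ} {θ₁ : K₁} (hθ₁ : θ₁ ^ 2 = algebraMap ℚ K₁ c₁) (hθ₁K : θ₁ ∉ Set.range (algebraMap ℚ K₁))
    (hdu₁ : ∀ (ℓ : ℕ) [Fact ℓ.Prime], Addv W ℓ → padicValRat ℓ c₁ = 0)
    (W₁ : WeierstrassCurve ℚ) [W₁.IsElliptic] [W₁.IsGloballyMinimal]
    (hW₁ : ∃ C : VariableChange ℚ, C • W.quadraticTwist c₁ = W₁) (hr₁ : W₁.analyticRank = 0)
    {N₁ : ℕ} [NeZero N₁] (D₁ : ModularParametrizationData W₁ N₁) (hcD₁ : ¬ (p : ℤ) ∣ D₁.maninConstant)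
    (V₁ : WeierstrassCurve K₁) [V₁.IsElliptic] (hV₁ : ∃ C : VariableChange K₁, C • W.baseChange K₁ = V₁)
    (hlow₁ : ∃ q₁ : ℚ, analyticSha V₁ = (q₁ : ℂ) ∧
      padicValRat p q₁ ≤ padicValNat p (Nat.card (AddCommGroup.primaryComponent V₁.sha p)))
    -- PACKAGE 2, for ONE minimal model `Wd₀` of the Heegner twist
    (Wd₀ : WeierstrassCurve ℚ) [Wd₀.IsElliptic] [Wd₀.IsGloballyMinimal] (Cd₀ : VariableChange ℚ)
    (hWd₀ : Cd₀ • W.quadraticTwist (NumberField.discr K : ℚ) = Wd₀)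
    (K₂ : Type) [Field K₂] [NumberField K₂] (h2₂ : Module.finrank ℚ K₂ = 2)
    {c₂ : ℚ} {θ₂ : K₂} (hθ₂ : θ₂ ^ 2 = algebraMap ℚ K₂ c₂) (hθ₂K : θ₂ ∉ Set.range (algebraMap ℚ K₂))
    (hdu₂ : ∀ (ℓ : ℕ) [Fact ℓ.Prime], Addv Wd₀ ℓ → padicValRat ℓ c₂ = 0)
    (W₂ : WeierstrassCurve ℚ) [W₂.IsElliptic] [W₂.IsGloballyMinimal]
    (hW₂ : ∃ C : VariableChange ℚ, C • Wd₀.quadraticTwist c₂ = W₂) (hr₂ : W₂.analyticRank = 0)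
    {N₂ : ℕ} [NeZero N₂] (D₂ : ModularParametrizationData W₂ N₂) (hcD₂ : ¬ (p : ℤ) ∣ D₂.maninConstant)
    (V₂ : WeierstrassCurve K₂) [V₂.IsElliptic] (hV₂ : ∃ C : VariableChange K₂, C • Wd₀.baseChange K₂ = V₂)
    (hlow₂ : ∃ q₂ : ℚ, analyticSha V₂ = (q₂ : ℂ) ∧
      padicValRat p q₂ ≤ padicValNat p (Nat.card (AddCommGroup.primaryComponent V₂.sha p))) :
    ∃ (n : ℕ) (d : KolyvaginHeegnerData Dt β ι n),
      KolyvaginDescent.KolSupp (Zhang2014.IsKolyvaginPrime (W.conductorNorm ℤ) W K p) n ∧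
        d.kolyvaginClass hp.out 1 ≠ 0 := by
  have hD0 : (NumberField.discr K : ℚ) ≠ 0 := by exact_mod_cast NumberField.discr_ne_zero K
  haveI hEt : (W.quadraticTwist (NumberField.discr K : ℚ)).IsElliptic := W.isElliptic_quadraticTwist hD0
  have hc₁0 : c₁ ≠ 0 := by
    rintro rfl
    rw [map_zero, pow_eq_zero_iff two_ne_zero] at hθ₁
    exact hθ₁K ⟨0, by rw [map_zero, hθ₁]⟩
  have hc₂0 : c₂ ≠ 0 := by
    rintro rfl
    rw [map_zero, pow_eq_zero_iff two_ne_zero] at hθ₂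
    exact hθ₂K ⟨0, by rw [map_zero, hθ₂]⟩
  -- Tamagawa binders from ♠(1): the frame, partner 1
  have htam : ¬ p ∣ W.tamagawaProduct := not_dvd_tamagawaProduct_of_spadeOne W p hp5 hsp
  have htam₁ : ¬ p ∣ W₁.tamagawaProduct :=
    QuadraticDescent.not_dvd_tamagawaProduct_of_model_unit_twist_of_spadeOne W p hp5 hsp h2 hc₁0 hdu₁ W₁ hW₁
  -- partner 2: ♠(1) and «not additive at 2» pass to `Wd₀`, then the unit twist by `c₂`
  have hsp₀ : ∀ (ℓ : ℕ) [Fact ℓ.Prime], Wd₀.HasMultiplicativeReductionAtPrime ℓ →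
      ¬ p ∣ padicValInt ℓ Wd₀.minimalDiscriminantInt :=
    QuadraticDescent.spadeOne_of_model_heegnerTwist W p hsp K hK hH Wd₀ Cd₀ hWd₀
  have h2₀ := good_or_mult_two_of_model_heegnerTwist W K hK hodd hH Wd₀ Cd₀ hWd₀ h2
  have htam₂ : ¬ p ∣ W₂.tamagawaProduct :=
    QuadraticDescent.not_dvd_tamagawaProduct_of_model_unit_twist_of_spadeOne Wd₀ p hp5 hsp₀ h2₀ hc₂0 hdu₂ W₂ hW₂
  -- `ord_p c_i = 0` from the unit conditions at the additive prime `p`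
  have hc₁ : padicValRat p c₁ = 0 := hdu₁ p hadd
  obtain ⟨-, hadd₀, -⟩ := AdditiveKolyvaginKernel.twist_nonCM_addv_rankZero hmod W p hCM hadd K hK hH hL Wd₀ Cd₀ hWd₀
  have hc₂ : padicValRat p c₂ = 0 := hdu₂ p hadd₀
  exact exists_kolyvaginClass_ne_zero_of_quadraticLowerHalves_of_kato W p K Dt β ι hGZ hKo hKoB hGZK hmod hMc hDD hKato hp5 hadd
    hpot hs hCM htam hr hK hodd hlt hH hL hβ hc K₁ h2₁ hθ₁ hθ₁K hc₁ W₁ hW₁ hr₁ htam₁ D₁ hcD₁ V₁ hV₁ hlow₁ Wd₀ Cd₀ hWd₀ K₂ h2₂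
    hθ₂ hθ₂K hc₂ W₂ hW₂ hr₂ htam₂ D₂ hcD₂ V₂ hV₂ hlow₂

end Frame

end Summit.BirchSwinnertonDyer.BirchSwinnertonDyer.Theorems.AdditiveKoly

end
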